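import Summits.Ventures.GridStability.Models.StructurePreservingInstance

/-!
# GridStability/Models/StructurePreservingEdgeFlow — node injections of edge-list couplings as
# signed sums of per-edge flows; EXACT rational injections at half-angle (tan δ/2) points

LADDER-GRIDFUSION rung «G2.b-SP NE39», route (b) «printed P» (lead 2026-08-27T01:16:41Z /
01:37:36Z; lyap-1's ask 01:31:32Z), seat gridfusion-model-2; MODEL-VALIDITY row MV-3. DATA-INDEPENDENT
companion of `StructurePreservingInstance.lean` (same instance kit, next screen):
* `netFlow src tgt F i = Σ_{e : src e = i} F e − Σ_{e : tgt e = i} F e` — the net OUT-flow at node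
  `i` of per-edge quantities `F` on an indexed edge list (`m` edges `src e → tgt e`); over `ℚ` it
  is finite data a kernel decision procedure evaluates, over `ℝ` it is the node balance;
  `netFlow_ratCast` moves the cast `ℚ → ℝ` through it;
* `edgeFlow src tgt wt δ e = wt e · sin(δ_{src e} − δ_{tgt e})` and the NODE BALANCE
  `Params.pe_eq_netFlow_edgeFlow`: for couplings `b = symmetrize (edgeWeight src tgt wt)` (the
  shape of every typed instance) the injection `fᵢ(δ) = Σⱼ bᵢⱼ sin(δᵢ − δⱼ)` is
  `netFlow src tgt (edgeFlow src tgt wt δ) i` — each listed edge enters with `+` at its source and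
  `−` at its target (antisymmetry of the sine), parallel entries add up;
* `halfFlow a b = (2a/(1+a²))·((1−b²)/(1+b²)) − ((1−a²)/(1+a²))·(2b/(1+b²))`
  (`= 2(a−b)(1+ab)/((1+a²)(1+b²))`, `halfFlow_eq`) is `sin(2·arctan a − 2·arctan b)`
  (`sin_halfAngle_sub`), a rational function over any field, cast-compatible (`halfFlow_ratCast`);
* `Params.pe_halfAngle_eq_ratCast` packages the EXACT EVALUATION: from two finite rational tables —
  per-edge `F_e = wt_e · halfFlow(t_src, t_tgt)` (`m` identities over `ℚ`) and per-node
  `G_i = netFlow F i` (`n` identities over `ℚ`) — it concludes `fᵢ(δ₀) = G_i` in `ℝ` at the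
  half-angle point `δ₀ = halfAngle t`, for every node. This is the per-node form in which the
  RESIDUAL hypothesis `4 Σ_{i ≠ r} (P_i − fᵢ(θ₀))² < μ²R²` of the tree's equilibrium-existence
  theorem (`Literature.MathematicalPhysics.PowerSystems.ClassicalModel.exists_equilibrium_of_residual_reference`,
  lit-1) becomes finitely many small rational comparisons.
Everything is PROVED; no instance data (model-4 custody; the NE39 tables live in
`NE39SPInjections.lean`); MODELLED column only — nothing here is a stability statement.
[cite: Padiyar2013, §3.2 eqs (3.2), (3.9)]; [cite: BergenHill1981].
-/

noncomputable section

open Finset Real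

namespace Summit.Ventures.GridStability.Models.StructurePreserving

variable {n m : ℕ}

/-! ## Net flow of per-edge quantities on an indexed edge list -/

/-- Net OUT-flow at node `i` of the per-edge quantities `F` on the indexed edge list
`src e → tgt e`: `Σ_{e : src e = i} F e − Σ_{e : tgt e = i} F e`. -/
def netFlow {α : Type*} [AddCommGroup α] (src tgt : Fin m → Fin n) (F : Fin m → α) (i : Fin n) :
    α :=
  (∑ e, if src e = i then F e else 0) - ∑ e, if tgt e = i then F e else 0

/-- `netFlow` commutes with the cast `ℚ → ℝ` (rational tables evaluate the real node balance). -/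
theorem netFlow_ratCast (src tgt : Fin m → Fin n) (F : Fin m → ℚ) (i : Fin n) :
    ((netFlow src tgt F i : ℚ) : ℝ) = netFlow src tgt (fun e => (F e : ℝ)) i := by
  unfold netFlow
  rw [Rat.cast_sub, Rat.cast_sum, Rat.cast_sum]
  congr 1 <;> exact Finset.sum_congr rfl fun e _ => by split_ifs <;> simp

/-! ## Per-edge flows and the node balance -/

/-- The flow carried by listed edge `e` (orientation `src e → tgt e`, weight `wt e`) at bus
angles `δ`: `wt e · sin(δ_{src e} − δ_{tgt e})`. -/
def edgeFlow (src tgt : Fin m → Fin n) (wt : Fin m → ℝ) (δ : Fin n → ℝ) (e : Fin m) : ℝ :=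
  wt e * Real.sin (δ (src e) - δ (tgt e))

/-- **Node balance of edge-list couplings**: for `b = symmetrize (edgeWeight src tgt wt)` the
injection `fᵢ(δ) = Σⱼ bᵢⱼ sin(δᵢ − δⱼ)` [cite: Padiyar2013, §3.2 eq (3.9)] at node `i` is the net
out-flow of the per-edge flows: `fᵢ(δ) = Σ_{e : src e = i} wt_e sin(δ_i − δ_{tgt e})
− Σ_{e : tgt e = i} wt_e sin(δ_{src e} − δ_i)`. -/
theorem Params.pe_eq_netFlow_edgeFlow (p : Params n) {src tgt : Fin m → Fin n} {wt : Fin m → ℝ}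
    (hb : p.b = symmetrize (edgeWeight src tgt wt)) (δ : Fin n → ℝ) (i : Fin n) :
    p.pe δ i = netFlow src tgt (edgeFlow src tgt wt δ) i := by
  classical
  -- source-oriented entries: `Σⱼ w(i,j) sin(δᵢ − δⱼ) = Σ_{e : src e = i} flow e`
  have hout : ∑ j, edgeWeight src tgt wt i j * Real.sin (δ i - δ j)
      = ∑ e, if src e = i then edgeFlow src tgt wt δ e else 0 := by
    simp only [edgeWeight, Finset.sum_mul]
    rw [Finset.sum_comm]
    refine Finset.sum_congr rfl fun e _ => ?_
    by_cases hs : src e = i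
    · subst hs
      rw [if_pos rfl, Finset.sum_eq_single (tgt e)]
      · rw [if_pos ⟨rfl, rfl⟩, edgeFlow]
      · intro j _ hj
        rw [if_neg (fun h => hj h.2.symm), zero_mul]
      · intro h; exact absurd (Finset.mem_univ _) h
    · rw [if_neg hs]
      exact Finset.sum_eq_zero fun j _ => by rw [if_neg (fun h => hs h.1), zero_mul]
  -- target-oriented entries: `Σⱼ w(j,i) sin(δᵢ − δⱼ) = −Σ_{e : tgt e = i} flow e`
  have hin : ∑ j, edgeWeight src tgt wt j i * Real.sin (δ i - δ j)
      = -∑ e, if tgt e = i then edgeFlow src tgt wt δ e else 0 := by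
    simp only [edgeWeight, Finset.sum_mul]
    rw [Finset.sum_comm, ← Finset.sum_neg_distrib]
    refine Finset.sum_congr rfl fun e _ => ?_
    by_cases ht : tgt e = i
    · subst ht
      rw [if_pos rfl, Finset.sum_eq_single (src e)]
      · rw [if_pos ⟨rfl, rfl⟩, edgeFlow, ← neg_sub (δ (src e)) (δ (tgt e)), Real.sin_neg, mul_neg]
      · intro j _ hj
        rw [if_neg (fun h => hj h.1.symm), zero_mul]
      · intro h; exact absurd (Finset.mem_univ _) h
    · rw [if_neg ht, neg_zero]
      exact Finset.sum_eq_zero fun j _ => by rw [if_neg (fun h => ht h.2), zero_mul]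
  unfold Params.pe netFlow
  rw [hb]
  simp only [symmetrize, add_mul, Finset.sum_add_distrib]
  rw [hout, hin, sub_eq_add_neg]

/-! ## The sine of a branch angle at a half-angle point is a rational function -/

/-- `halfFlow a b = (2a/(1+a²))·((1−b²)/(1+b²)) − ((1−a²)/(1+a²))·(2b/(1+b²))` — the value of
`sin(2·arctan a − 2·arctan b)` (`sin_halfAngle_sub`); a rational function over any field. -/
def halfFlow {K : Type*} [Field K] (a b : K) : K :=
  2 * a / (1 + a ^ 2) * ((1 - b ^ 2) / (1 + b ^ 2)) - (1 - a ^ 2) / (1 + a ^ 2) * (2 * b / (1 + b ^ 2))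

/-- Closed form `halfFlow a b = 2(a − b)(1 + ab)/((1 + a²)(1 + b²))` (reals). -/
theorem halfFlow_eq (a b : ℝ) :
    halfFlow a b = 2 * (a - b) * (1 + a * b) / ((1 + a ^ 2) * (1 + b ^ 2)) := by
  unfold halfFlow
  have ha : (0 : ℝ) < 1 + a ^ 2 := by positivity
  have hb : (0 : ℝ) < 1 + b ^ 2 := by positivity
  field_simp
  ring

/-- `halfFlow` is antisymmetric: reversing an edge flips the sign of its flow. -/
theorem halfFlow_swap {K : Type*} [Field K] (a b : K) : halfFlow b a = -halfFlow a b := by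
  unfold halfFlow; ring

/-- `halfFlow` commutes with the cast `ℚ → ℝ`. -/
theorem halfFlow_ratCast (a b : ℚ) : ((halfFlow a b : ℚ) : ℝ) = halfFlow (a : ℝ) (b : ℝ) := by
  unfold halfFlow; push_cast; ring

/-- **Branch-angle sine at a half-angle point**: `sin(δᵢ − δⱼ) = halfFlow tᵢ tⱼ` for
`δ = halfAngle t` (`sin(A − B) = sin A cos B − cos A sin B` with the rational `sin_halfAngle`,
`cos_halfAngle`). -/
theorem sin_halfAngle_sub (t : Fin n → ℝ) (i j : Fin n) :
    Real.sin (halfAngle t i - halfAngle t j) = halfFlow (t i) (t j) := by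
  rw [Real.sin_sub, sin_halfAngle, cos_halfAngle, sin_halfAngle, cos_halfAngle]
  simp only [halfSin, halfCos, halfFlow]

/-- The flow on a listed edge at a half-angle point: `wt_e · halfFlow(t_{src e}, t_{tgt e})`. -/
theorem edgeFlow_halfAngle (src tgt : Fin m → Fin n) (wt : Fin m → ℝ) (t : Fin n → ℝ) (e : Fin m) :
    edgeFlow src tgt wt (halfAngle t) e = wt e * halfFlow (t (src e)) (t (tgt e)) := by
  rw [edgeFlow, sin_halfAngle_sub]

/-! ## Exact injections at a half-angle point from two rational tables -/

/-- **Exact per-node injections from finite rational data.** Let the couplings be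
`b = symmetrize (edgeWeight src tgt wt)` with RATIONAL weights `wt = wtQ` and let `δ₀ = halfAngle tQ`
be a half-angle point with RATIONAL tangents. If a per-edge table `FQ` satisfies the `m` rational
identities `wtQ e · halfFlow (tQ (src e)) (tQ (tgt e)) = FQ e` and a per-node table `GQ` the `n`
rational identities `netFlow src tgt FQ i = GQ i`, then `fᵢ(δ₀) = GQ i` EXACTLY for every node —
no transcendental function and no real arithmetic left (the two tables are checked by `decide` /
`norm_num` in the instance file). -/
theorem Params.pe_halfAngle_eq_ratCast (p : Params n) {src tgt : Fin m → Fin n} (wtQ : Fin m → ℚ)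
    (tQ : Fin n → ℚ) (hb : p.b = symmetrize (edgeWeight src tgt fun e => (wtQ e : ℝ)))
    (FQ : Fin m → ℚ) (hF : ∀ e, wtQ e * halfFlow (tQ (src e)) (tQ (tgt e)) = FQ e)
    (GQ : Fin n → ℚ) (hG : ∀ i, netFlow src tgt FQ i = GQ i) (i : Fin n) :
    p.pe (halfAngle fun k => (tQ k : ℝ)) i = (GQ i : ℝ) := by
  have hflow : edgeFlow src tgt (fun e => (wtQ e : ℝ)) (halfAngle fun k => (tQ k : ℝ))
      = fun e => ((FQ e : ℚ) : ℝ) := by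
    funext e
    rw [edgeFlow_halfAngle, ← hF e, Rat.cast_mul, halfFlow_ratCast]
  rw [p.pe_eq_netFlow_edgeFlow hb, hflow, ← netFlow_ratCast, hG i]

/-- Corollary: with `P⁰ := f(δ₀)` (eq=b) the injected powers ARE the per-node table,
`P⁰ᵢ = GQ i`. -/
theorem Params.P0_eq_ratCast_of_P0_eq_pe (p : Params n) {src tgt : Fin m → Fin n}
    (wtQ : Fin m → ℚ) (tQ : Fin n → ℚ)
    (hb : p.b = symmetrize (edgeWeight src tgt fun e => (wtQ e : ℝ)))
    (hP : p.P0 = p.pe (halfAngle fun k => (tQ k : ℝ)))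
    (FQ : Fin m → ℚ) (hF : ∀ e, wtQ e * halfFlow (tQ (src e)) (tQ (tgt e)) = FQ e)
    (GQ : Fin n → ℚ) (hG : ∀ i, netFlow src tgt FQ i = GQ i) (i : Fin n) :
    p.P0 i = (GQ i : ℝ) := by
  rw [hP, p.pe_halfAngle_eq_ratCast wtQ tQ hb FQ hF GQ hG i]

end Summit.Ventures.GridStability.Models.StructurePreserving

end
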